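import Summits.NavierStokesRegularity.NavierStokesRegularity.Theorems.PerpetualPumpThesisTameDuhamelBoundEuler

/-!
# Stub `tameDuhamelBound` for `PerpetualPump.Thesis`, part III: dyadic pieces of the Euler form

Support file (part 3 of the stub `tameDuhamelBound` of line `SketchIdeator2`, crux
stmt-NavierStokesRegularity-1832). The paraproduct estimate for Tao's Euler form
`⟨B(F,G), H⟩` (J. Amer. Math. Soc. 29 (2016), (1.3)) decomposes `F = ∑_j Δ̇_j F`, `G = ∑_k Δ̇_k G`
into the homogeneous Littlewood–Paley pieces of `Literature/Analysis/FunctionSpaces/LittlewoodPaley.lean`,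
realised on `L²(ℝ³; ℂ³)` as Tao's multipliers `P_j F = φ_j(D) F`
(`fourierMultiplier ((memLp_top_dyadicSymbol j).toLp _) F`). This file records the pieces:

* `FB.eLpNorm_blockPiece`: `‖P_j F‖_{L^∞} = ‖Δ̇_j F‖_{L^∞}` (the `j`-th term of `‖F‖_{Ḃ⁰_{∞,1}}`),
  `FB.enorm_blockPiece_le`: `‖P_j F‖_{L²} ≤ 2 ‖1_{2^{j-1}<|ξ|<2^{j+1}} F̂‖_{L²}`, and `P_j F` is
  divergence free with `𝓕(P_j F) ∈ L¹`;
* `FB.eulerForm_cutoff_eq`: a Fourier cutoff `ψ(D)` on the third slot that equals `1` on the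
  Minkowski sum of the Fourier supports of the first two slots does not change the Euler form;
* `FB.enorm_eulerForm_pieces_le`: the **master bound**
  `|⟨B(P_jF, P_kG), H⟩| ≤ 72π ‖Δ̇_jF‖_{L^∞} ‖1_{ann_k}Ĝ‖_{L²} ‖1_S |ξ| Ĥ‖_{L²}` for any cutoff `ψ`,
  `|ψ| ≤ 2`, `ψ = 1` on `-(ann_j + ann_k)`, `ψ = 0` off `S` (part II applied to the pieces).

## References

* T. Tao, J. Amer. Math. Soc. 29 (2016), 601–674, §1.1 (1.3)–(1.4).
* H. Bahouri, J.-Y. Chemin, R. Danchin, *Fourier Analysis and Nonlinear PDE* (2011), §2.6.1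
  (Bony's decomposition).
-/

noncomputable section

open MeasureTheory Filter Topology FourierTransform Real Complex
open scoped SchwartzMap ENNReal NNReal FourierTransform

set_option linter.dupNamespace false

namespace Summit.NavierStokesRegularity.NavierStokesRegularity.Theorems.PerpetualPumpThesis.FB

open Literature.Analysis.FunctionSpaces Literature.Analysis.FluidPDE
  Literature.Analysis.FluidPDE.Tao2016

/-! ### The dyadic pieces `P_j F = φ_j(D) F` on `L²(ℝ³; ℂ³)` -/

/-- The Fourier transform of the piece `P_j F` is `φ_j F̂` (a.e.). -/
theorem fourierFn_blockPiece (j : ℤ) (F : L2C) :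
    fourierFn (fourierMultiplier ((memLp_top_dyadicSymbol (E := EuclideanSpace ℝ (Fin 3)) j).toLp _) F)
      =ᵐ[volume] fun ξ => dyadicSymbol j ξ • fourierFn F ξ :=
  fourierFn_fourierMultiplier_toLp _ F

/-- The Fourier transform of a piece is integrable (compact frequency support). -/
theorem integrable_fourierFn_blockPiece (j : ℤ) (F : L2C) :
    Integrable (fourierFn (fourierMultiplier
      ((memLp_top_dyadicSymbol (E := EuclideanSpace ℝ (Fin 3)) j).toLp _) F)) :=
  (FA.integrable_dyadicSymbol_smul_fourierFn j F).congr (fourierFn_blockPiece j F).symm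

/-- The piece of a divergence-free field is divergence free. -/
theorem isFourierDivFree_blockPiece (j : ℤ) {F : L2C} (hF : IsFourierDivFree F) :
    IsFourierDivFree (fourierMultiplier
      ((memLp_top_dyadicSymbol (E := EuclideanSpace ℝ (Fin 3)) j).toLp _) F) :=
  hF.fourierMultiplier _

/-- **The piece is the Littlewood–Paley block** as a tempered distribution: `P_j F = Δ̇_j F`. -/
theorem coe_blockPiece (j : ℤ) (F : L2C) :
    ((fourierMultiplier ((memLp_top_dyadicSymbol (E := EuclideanSpace ℝ (Fin 3)) j).toLp _) F : L2C) :
        𝓢'(EuclideanSpace ℝ (Fin 3), EuclideanSpace ℂ (Fin 3))) =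
      lpBlock j ((F : L2C) : 𝓢'(EuclideanSpace ℝ (Fin 3), EuclideanSpace ℂ (Fin 3))) := by
  rw [lpBlock_apply]
  exact FA.coe_fourierMultiplier (hasTemperateGrowth_dyadicSymbol j) (memLp_top_dyadicSymbol j) F

/-- **`‖P_j F‖_{L^∞} = ‖Δ̇_j F‖_{L^∞}`**, the `j`-th term of the `Ḃ⁰_{∞,1}` norm of `F`. -/
theorem eLpNorm_blockPiece (j : ℤ) (F : L2C) :
    eLpNorm ((fourierMultiplier ((memLp_top_dyadicSymbol (E := EuclideanSpace ℝ (Fin 3)) j).toLp _) F :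
        L2C) : EuclideanSpace ℝ (Fin 3) → EuclideanSpace ℂ (Fin 3)) ∞ volume =
      eLpNormDistrib ∞ (lpBlock j ((F : L2C) : 𝓢'(EuclideanSpace ℝ (Fin 3), EuclideanSpace ℂ (Fin 3)))) := by
  rw [← coe_blockPiece, PerpetualPumpThesis.F.eLpNormDistrib_coe_two_eq_eLpNorm]

/-- The dyadic annulus `{2^{j-1} < |ξ| < 2^{j+1}}` (and its widenings) is measurable. -/
theorem measurableSet_annulus (a b : ℝ) :
    MeasurableSet {ξ : EuclideanSpace ℝ (Fin 3) | a < ‖ξ‖ ∧ ‖ξ‖ < b} :=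
  (measurableSet_lt measurable_const measurable_norm).inter
    (measurableSet_lt measurable_norm measurable_const)

/-- `|φ_j(ξ)|² ≤ 4 · 1_{2^{j-1} < |ξ| < 2^{j+1}}`. -/
theorem enorm_dyadicSymbol_sq_le_indicator (j : ℤ) (ξ : EuclideanSpace ℝ (Fin 3)) :
    ‖dyadicSymbol j ξ‖ₑ ^ 2 ≤
      4 * {ξ : EuclideanSpace ℝ (Fin 3) | (2 : ℝ) ^ (j - 1) < ‖ξ‖ ∧ ‖ξ‖ < (2 : ℝ) ^ (j + 1)}.indicator
        (fun _ => (1 : ℝ≥0∞)) ξ := by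
  by_cases h : (2 : ℝ) ^ (j - 1) < ‖ξ‖ ∧ ‖ξ‖ < (2 : ℝ) ^ (j + 1)
  · rw [Set.indicator_of_mem (show ξ ∈ {ξ : EuclideanSpace ℝ (Fin 3) |
      (2 : ℝ) ^ (j - 1) < ‖ξ‖ ∧ ‖ξ‖ < (2 : ℝ) ^ (j + 1)} from h), mul_one]
    exact enorm_dyadicSymbol_sq_le_four j ξ
  · have h0 : dyadicSymbol j ξ = 0 := by
      rcases not_and_or.1 h with h1 | h1
      · exact dyadicSymbol_apply_of_norm_le_holds (not_lt.1 h1)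
      · exact dyadicSymbol_apply_of_le_norm_holds (not_lt.1 h1)
    rw [h0]
    simp

/-- **`‖P_j F‖²_{L²} ≤ 4 ∫_{2^{j-1}<|ξ|<2^{j+1}} |F̂|²`** (Plancherel, `|φ_j| ≤ 2` on its annulus). -/
theorem enorm_blockPiece_sq_le (j : ℤ) (F : L2C) :
    ‖fourierMultiplier ((memLp_top_dyadicSymbol (E := EuclideanSpace ℝ (Fin 3)) j).toLp _) F‖ₑ ^ 2 ≤
      4 * ∫⁻ ξ in {ξ : EuclideanSpace ℝ (Fin 3) | (2 : ℝ) ^ (j - 1) < ‖ξ‖ ∧ ‖ξ‖ < (2 : ℝ) ^ (j + 1)},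
        ‖fourierFn F ξ‖ₑ ^ 2 := by
  have h := enorm_fourierInv_smul_fourier_sq (memLp_top_dyadicSymbol (E := EuclideanSpace ℝ (Fin 3)) j) F
  change ‖fourierMultiplier ((memLp_top_dyadicSymbol (E := EuclideanSpace ℝ (Fin 3)) j).toLp _) F‖ₑ ^ 2 =
    ∫⁻ ξ, ‖dyadicSymbol j ξ‖ₑ ^ 2 * ‖fourierFn F ξ‖ₑ ^ 2 at h
  rw [h, ← lintegral_indicator (measurableSet_annulus _ _),
    ← lintegral_const_mul' _ _ (by norm_num)]
  refine lintegral_mono fun ξ => ?_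
  calc ‖dyadicSymbol j ξ‖ₑ ^ 2 * ‖fourierFn F ξ‖ₑ ^ 2
      ≤ 4 * {ξ : EuclideanSpace ℝ (Fin 3) | (2 : ℝ) ^ (j - 1) < ‖ξ‖ ∧ ‖ξ‖ < (2 : ℝ) ^ (j + 1)}.indicator
          (fun _ => (1 : ℝ≥0∞)) ξ * ‖fourierFn F ξ‖ₑ ^ 2 :=
        mul_le_mul' (enorm_dyadicSymbol_sq_le_indicator j ξ) le_rfl
    _ = 4 * {ξ : EuclideanSpace ℝ (Fin 3) | (2 : ℝ) ^ (j - 1) < ‖ξ‖ ∧ ‖ξ‖ < (2 : ℝ) ^ (j + 1)}.indicator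
          (fun ξ => ‖fourierFn F ξ‖ₑ ^ 2) ξ := by
        rw [mul_assoc]
        congr 1
        by_cases hξ : ξ ∈ {ξ : EuclideanSpace ℝ (Fin 3) | (2 : ℝ) ^ (j - 1) < ‖ξ‖ ∧ ‖ξ‖ < (2 : ℝ) ^ (j + 1)}
        · rw [Set.indicator_of_mem hξ, Set.indicator_of_mem hξ, one_mul]
        · rw [Set.indicator_of_notMem hξ, Set.indicator_of_notMem hξ, zero_mul]

/-- **`‖P_j F‖_{L²} ≤ 2 ‖1_{2^{j-1}<|ξ|<2^{j+1}} F̂‖_{L²}`**. -/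
theorem enorm_blockPiece_le (j : ℤ) (F : L2C) :
    ‖fourierMultiplier ((memLp_top_dyadicSymbol (E := EuclideanSpace ℝ (Fin 3)) j).toLp _) F‖ₑ ≤
      2 * (∫⁻ ξ in {ξ : EuclideanSpace ℝ (Fin 3) | (2 : ℝ) ^ (j - 1) < ‖ξ‖ ∧ ‖ξ‖ < (2 : ℝ) ^ (j + 1)},
        ‖fourierFn F ξ‖ₑ ^ 2) ^ (1 / 2 : ℝ) := by
  have h := enorm_blockPiece_sq_le j F
  have h2 : (4 : ℝ≥0∞) = 2 ^ (2 : ℝ) := by rw [ENNReal.rpow_two]; norm_num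
  calc ‖fourierMultiplier ((memLp_top_dyadicSymbol (E := EuclideanSpace ℝ (Fin 3)) j).toLp _) F‖ₑ
      = (‖fourierMultiplier ((memLp_top_dyadicSymbol (E := EuclideanSpace ℝ (Fin 3)) j).toLp _) F‖ₑ ^ 2) ^
          (1 / 2 : ℝ) := by
        rw [← ENNReal.rpow_natCast, ← ENNReal.rpow_mul]; norm_num
    _ ≤ (4 * ∫⁻ ξ in {ξ : EuclideanSpace ℝ (Fin 3) | (2 : ℝ) ^ (j - 1) < ‖ξ‖ ∧ ‖ξ‖ < (2 : ℝ) ^ (j + 1)},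
          ‖fourierFn F ξ‖ₑ ^ 2) ^ (1 / 2 : ℝ) := ENNReal.rpow_le_rpow h (by norm_num)
    _ = _ := by
        rw [ENNReal.mul_rpow_of_nonneg _ _ (by norm_num : (0 : ℝ) ≤ 1 / 2), h2, ← ENNReal.rpow_mul]
        norm_num

/-- The Fourier transform of `P_j F` vanishes off the annulus `2^{j-1} < |ξ| < 2^{j+1}` (a.e.). -/
theorem fourierFn_blockPiece_eq_zero (j : ℤ) (F : L2C) :
    ∀ᵐ ξ ∂(volume : Measure (EuclideanSpace ℝ (Fin 3))),
      ξ ∉ {ξ : EuclideanSpace ℝ (Fin 3) | (2 : ℝ) ^ (j - 1) < ‖ξ‖ ∧ ‖ξ‖ < (2 : ℝ) ^ (j + 1)} →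
        fourierFn (fourierMultiplier
          ((memLp_top_dyadicSymbol (E := EuclideanSpace ℝ (Fin 3)) j).toLp _) F) ξ = 0 := by
  filter_upwards [fourierFn_blockPiece j F] with ξ hξ hmem
  rw [hξ]
  have h0 : dyadicSymbol j ξ = 0 := by
    rcases not_and_or.1 hmem with h1 | h1
    · exact dyadicSymbol_apply_of_norm_le_holds (not_lt.1 h1)
    · exact dyadicSymbol_apply_of_le_norm_holds (not_lt.1 h1)
  rw [h0, zero_smul]

/-! ### Fourier cutoffs on the third slot -/

/-- **A Fourier cutoff on the third slot that is `1` on the interaction region is invisible**: if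
`X̂` vanishes off `S`, `Ŷ` vanishes off `T` and `ψ(-ξ₁-ξ₂) = 1` for `ξ₁ ∈ S`, `ξ₂ ∈ T`, then
`⟨B(X,Y), ψ(D)H⟩ = ⟨B(X,Y), H⟩` (the integrands of (1.3) agree a.e.; no convergence needed). -/
theorem eulerForm_cutoff_eq (X Y H : L2C) {ψ : EuclideanSpace ℝ (Fin 3) → ℂ}
    (hψ : MemLp ψ ∞ (volume : Measure (EuclideanSpace ℝ (Fin 3)))) {S T : Set (EuclideanSpace ℝ (Fin 3))}
    (hX : ∀ᵐ ξ ∂(volume : Measure (EuclideanSpace ℝ (Fin 3))), ξ ∉ S → fourierFn X ξ = 0)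
    (hY : ∀ᵐ ξ ∂(volume : Measure (EuclideanSpace ℝ (Fin 3))), ξ ∉ T → fourierFn Y ξ = 0)
    (h1 : ∀ ξ₁ ∈ S, ∀ ξ₂ ∈ T, ψ (-ξ₁ - ξ₂) = 1) :
    eulerForm X Y (fourierMultiplier (hψ.toLp ψ) H) = eulerForm X Y H := by
  unfold eulerForm
  congr 1
  rw [Measure.volume_eq_prod]
  refine integral_congr_ae ?_
  have hX' := (Measure.quasiMeasurePreserving_fst (μ := (volume : Measure (EuclideanSpace ℝ (Fin 3))))
    (ν := (volume : Measure (EuclideanSpace ℝ (Fin 3))))).ae hX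
  have hY' := (Measure.quasiMeasurePreserving_snd (μ := (volume : Measure (EuclideanSpace ℝ (Fin 3))))
    (ν := (volume : Measure (EuclideanSpace ℝ (Fin 3))))).ae hY
  have hH' := quasiMeasurePreserving_neg_fst_sub_snd.ae_eq (fourierFn_fourierMultiplier_toLp hψ H)
  filter_upwards [hX', hY', hH'] with p hp1 hp2 hp3
  simp only [Function.comp_apply] at hp3
  rw [hp3]
  by_cases hS : p.1 ∈ S
  · by_cases hT : p.2 ∈ T
    · rw [h1 _ hS _ hT, one_smul]
    · rw [hp2 hT]
      simp [Λ, cdot]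
  · rw [hp1 hS]
    simp [Λ, cdot]

/-- **The truncated third factor**: if `|ψ| ≤ 2` and `ψ = 0` off `S`, then
`‖|ξ| 𝓕(ψ(D)H)‖²_{L²} ≤ 4 ∫_S |ξ|² |Ĥ|²`. -/
theorem lintegral_cutoff_le (H : L2C) {ψ : EuclideanSpace ℝ (Fin 3) → ℂ}
    (hψ : MemLp ψ ∞ (volume : Measure (EuclideanSpace ℝ (Fin 3)))) (hψ2 : ∀ η, ‖ψ η‖ ≤ 2)
    {S : Set (EuclideanSpace ℝ (Fin 3))} (hS : MeasurableSet S) (hψS : ∀ η ∉ S, ψ η = 0) :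
    ∫⁻ η, (‖η‖ₑ * ‖fourierFn (fourierMultiplier (hψ.toLp ψ) H) η‖ₑ) ^ 2 ≤
      4 * ∫⁻ η in S, ‖η‖ₑ ^ 2 * ‖fourierFn H η‖ₑ ^ 2 := by
  rw [← lintegral_indicator hS, ← lintegral_const_mul' _ _ (by norm_num),
    lintegral_congr_ae ((fourierFn_fourierMultiplier_toLp hψ H).mono fun η hη => by rw [hη])]
  refine lintegral_mono fun η => ?_
  dsimp only
  by_cases hη : η ∈ S
  · rw [Set.indicator_of_mem hη, enorm_smul, mul_pow, mul_pow]
    have hψ4 : ‖ψ η‖ₑ ^ 2 ≤ 4 := by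
      rw [← ofReal_norm, ← ENNReal.ofReal_pow (norm_nonneg _)]
      have h4 : ‖ψ η‖ ^ 2 ≤ 4 := by nlinarith [hψ2 η, norm_nonneg (ψ η)]
      calc ENNReal.ofReal (‖ψ η‖ ^ 2) ≤ ENNReal.ofReal 4 := ENNReal.ofReal_le_ofReal h4
        _ = 4 := ENNReal.ofReal_ofNat 4
    calc ‖η‖ₑ ^ 2 * (‖ψ η‖ₑ ^ 2 * ‖fourierFn H η‖ₑ ^ 2)
        = ‖ψ η‖ₑ ^ 2 * (‖η‖ₑ ^ 2 * ‖fourierFn H η‖ₑ ^ 2) := by ring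
      _ ≤ 4 * (‖η‖ₑ ^ 2 * ‖fourierFn H η‖ₑ ^ 2) := mul_le_mul' hψ4 le_rfl
  · rw [hψS η hη, zero_smul, Set.indicator_of_notMem hη]
    simp

/-! ### The master bound for a pair of pieces -/

/-- The truncated third factor has finite weighted norm when `∫_S |ξ|²|Ĥ|² < ∞`. -/
theorem lintegral_cutoff_lt_top (H : L2C) {ψ : EuclideanSpace ℝ (Fin 3) → ℂ}
    (hψ : MemLp ψ ∞ (volume : Measure (EuclideanSpace ℝ (Fin 3)))) (hψ2 : ∀ η, ‖ψ η‖ ≤ 2)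
    {S : Set (EuclideanSpace ℝ (Fin 3))} (hS : MeasurableSet S) (hψS : ∀ η ∉ S, ψ η = 0)
    (hfin : ∫⁻ η in S, ‖η‖ₑ ^ 2 * ‖fourierFn H η‖ₑ ^ 2 < ⊤) :
    ∫⁻ η, (‖η‖ₑ * ‖fourierFn (fourierMultiplier (hψ.toLp ψ) H) η‖ₑ) ^ 2 < ⊤ :=
  lt_of_le_of_lt (lintegral_cutoff_le H hψ hψ2 hS hψS) (ENNReal.mul_lt_top (by norm_num) hfin)

/-- **The master bound for a pair of dyadic pieces.** Let `F, G ∈ L²(ℝ³; ℂ³)` be divergence free,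
`j, k ∈ ℤ`, and let `ψ` be a bounded symbol (`|ψ| ≤ 2`) with `ψ(-ξ₁-ξ₂) = 1` whenever
`2^{j-1} < |ξ₁| < 2^{j+1}` and `2^{k-1} < |ξ₂| < 2^{k+1}`, vanishing off a measurable set `S` on
which `∫_S |ξ|²|Ĥ|² < ∞`. Then
`|⟨B(P_jF, P_kG), H⟩| ≤ 72π ‖Δ̇_jF‖_{L^∞} ‖1_{ann_k} Ĝ‖_{L²} ‖1_S |ξ| Ĥ‖_{L²}`. -/
theorem enorm_eulerForm_pieces_le {F G : L2C} (H : L2C) (hF : IsFourierDivFree F)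
    (hG : IsFourierDivFree G) (j k : ℤ) {ψ : EuclideanSpace ℝ (Fin 3) → ℂ}
    (hψ : MemLp ψ ∞ (volume : Measure (EuclideanSpace ℝ (Fin 3)))) (hψ2 : ∀ η, ‖ψ η‖ ≤ 2)
    (h1 : ∀ ξ₁ ∈ {ξ : EuclideanSpace ℝ (Fin 3) | (2 : ℝ) ^ (j - 1) < ‖ξ‖ ∧ ‖ξ‖ < (2 : ℝ) ^ (j + 1)},
      ∀ ξ₂ ∈ {ξ : EuclideanSpace ℝ (Fin 3) | (2 : ℝ) ^ (k - 1) < ‖ξ‖ ∧ ‖ξ‖ < (2 : ℝ) ^ (k + 1)},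
        ψ (-ξ₁ - ξ₂) = 1)
    {S : Set (EuclideanSpace ℝ (Fin 3))} (hS : MeasurableSet S) (hψS : ∀ η ∉ S, ψ η = 0)
    (hfin : ∫⁻ η in S, ‖η‖ₑ ^ 2 * ‖fourierFn H η‖ₑ ^ 2 < ⊤) :
    ‖eulerForm (fourierMultiplier ((memLp_top_dyadicSymbol (E := EuclideanSpace ℝ (Fin 3)) j).toLp _) F)
        (fourierMultiplier ((memLp_top_dyadicSymbol (E := EuclideanSpace ℝ (Fin 3)) k).toLp _) G) H‖ₑ ≤
      ENNReal.ofReal (72 * π) *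
        eLpNormDistrib ∞ (lpBlock j ((F : L2C) : 𝓢'(EuclideanSpace ℝ (Fin 3), EuclideanSpace ℂ (Fin 3)))) *
        (∫⁻ ξ in {ξ : EuclideanSpace ℝ (Fin 3) | (2 : ℝ) ^ (k - 1) < ‖ξ‖ ∧ ‖ξ‖ < (2 : ℝ) ^ (k + 1)},
          ‖fourierFn G ξ‖ₑ ^ 2) ^ (1 / 2 : ℝ) *
        (∫⁻ η in S, ‖η‖ₑ ^ 2 * ‖fourierFn H η‖ₑ ^ 2) ^ (1 / 2 : ℝ) := by
  set Pj : L2C := fourierMultiplier ((memLp_top_dyadicSymbol (E := EuclideanSpace ℝ (Fin 3)) j).toLp _) F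
    with hPj
  set Pk : L2C := fourierMultiplier ((memLp_top_dyadicSymbol (E := EuclideanSpace ℝ (Fin 3)) k).toLp _) G
    with hPk
  set Hψ : L2C := fourierMultiplier (hψ.toLp ψ) H with hHψ
  have hcut : eulerForm Pj Pk Hψ = eulerForm Pj Pk H :=
    eulerForm_cutoff_eq Pj Pk H hψ (fourierFn_blockPiece_eq_zero j F) (fourierFn_blockPiece_eq_zero k G) h1
  have hE := enorm_eulerForm_le_localized (H := Hψ) (isFourierDivFree_blockPiece j hF)
    (isFourierDivFree_blockPiece k hG) (integrable_fourierFn_blockPiece j F)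
    (lintegral_cutoff_lt_top H hψ hψ2 hS hψS hfin)
  rw [hcut, eLpNorm_blockPiece] at hE
  have h3 : (∫⁻ η, (‖η‖ₑ * ‖fourierFn Hψ η‖ₑ) ^ 2) ^ (1 / 2 : ℝ) ≤
      2 * (∫⁻ η in S, ‖η‖ₑ ^ 2 * ‖fourierFn H η‖ₑ ^ 2) ^ (1 / 2 : ℝ) := by
    have h4 : (4 : ℝ≥0∞) = 2 ^ (2 : ℝ) := by rw [ENNReal.rpow_two]; norm_num
    calc (∫⁻ η, (‖η‖ₑ * ‖fourierFn Hψ η‖ₑ) ^ 2) ^ (1 / 2 : ℝ)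
        ≤ (4 * ∫⁻ η in S, ‖η‖ₑ ^ 2 * ‖fourierFn H η‖ₑ ^ 2) ^ (1 / 2 : ℝ) :=
          ENNReal.rpow_le_rpow (lintegral_cutoff_le H hψ hψ2 hS hψS) (by norm_num)
      _ = _ := by
          rw [ENNReal.mul_rpow_of_nonneg _ _ (by norm_num : (0 : ℝ) ≤ 1 / 2), h4, ← ENNReal.rpow_mul]
          norm_num
  refine hE.trans ?_
  calc ENNReal.ofReal (18 * π) *
        eLpNormDistrib ∞ (lpBlock j ((F : L2C) : 𝓢'(EuclideanSpace ℝ (Fin 3), EuclideanSpace ℂ (Fin 3)))) *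
        ‖Pk‖ₑ * (∫⁻ η, (‖η‖ₑ * ‖fourierFn Hψ η‖ₑ) ^ 2) ^ (1 / 2 : ℝ)
      ≤ ENNReal.ofReal (18 * π) *
        eLpNormDistrib ∞ (lpBlock j ((F : L2C) : 𝓢'(EuclideanSpace ℝ (Fin 3), EuclideanSpace ℂ (Fin 3)))) *
        (2 * (∫⁻ ξ in {ξ : EuclideanSpace ℝ (Fin 3) | (2 : ℝ) ^ (k - 1) < ‖ξ‖ ∧ ‖ξ‖ < (2 : ℝ) ^ (k + 1)},
          ‖fourierFn G ξ‖ₑ ^ 2) ^ (1 / 2 : ℝ)) *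
        (2 * (∫⁻ η in S, ‖η‖ₑ ^ 2 * ‖fourierFn H η‖ₑ ^ 2) ^ (1 / 2 : ℝ)) := by
        gcongr
        exact enorm_blockPiece_le k G
    _ = _ := by
        rw [show ENNReal.ofReal (72 * π) = ENNReal.ofReal (18 * π) * 4 by
          rw [show (72 : ℝ) * π = 18 * π * 4 by ring, ENNReal.ofReal_mul (by positivity),
            ENNReal.ofReal_ofNat]]
        ring

end Summit.NavierStokesRegularity.NavierStokesRegularity.Theorems.PerpetualPumpThesis.FB


namespace Summit.NavierStokesRegularity.NavierStokesRegularity.Theorems.PerpetualPumpThesis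

open MeasureTheory
open Literature.Analysis.FluidPDE Literature.Analysis.FluidPDE.Tao2016
open Literature.Analysis.FunctionSpaces

/-- **Part Pieces of stub `tameDuhamelBound` (registered sub-goal `stub_FB_Pieces`)**: a Fourier
cutoff `ψ(D)` on the third slot of Tao's Euler form that equals `1` on the interaction region
`-(S + T)` of the Fourier supports `S`, `T` of the first two slots is invisible,
`⟨B(X,Y), ψ(D)H⟩ = ⟨B(X,Y), H⟩` — the bookkeeping device of Bony's decomposition for the pieces
`X = Δ̇_jF`, `Y = Δ̇_kG` of the paraproduct estimate of line `SketchIdeator2`. -/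
theorem stub_FB_Pieces : ∀ (X Y H : L2C) (ψ : EuclideanSpace ℝ (Fin 3) → ℂ) (hψ : MemLp ψ ⊤ (volume : Measure (EuclideanSpace ℝ (Fin 3)))) (S T : Set (EuclideanSpace ℝ (Fin 3))), (∀ᵐ ξ ∂(volume : Measure (EuclideanSpace ℝ (Fin 3))), ξ ∉ S → fourierFn X ξ = 0) → (∀ᵐ ξ ∂(volume : Measure (EuclideanSpace ℝ (Fin 3))), ξ ∉ T → fourierFn Y ξ = 0) → (∀ ξ₁ ∈ S, ∀ ξ₂ ∈ T, ψ (-ξ₁ - ξ₂) = 1) → eulerForm X Y (fourierMultiplier (hψ.toLp ψ) H) = eulerForm X Y H :=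
  fun X Y H _ hψ _ _ hX hY h1 => FB.eulerForm_cutoff_eq X Y H hψ hX hY h1

end Summit.NavierStokesRegularity.NavierStokesRegularity.Theorems.PerpetualPumpThesis
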